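import Summits.BirchSwinnertonDyer.Rank1Residual.X2.ClassClosureO9OptimalMemberRiemannSum
import Literature.NumberTheory.EllipticCurves.AgasheRibetStein2006.ManinConstantO9Window
import HarnessLib

/-!
# O9 (X2c), NON-SPLIT window: the engine-currency Riemann-sum consumer ON THE 118 CURVE-`1` MODELS of
# `cremonaCurveOneO9Window` — optimality and Manin constant from the two registered Agashe–Ribet–Stein
# facts, so per pair the inputs are the class predicate, the instrument specification `hx` and ONE
# inequality (cell `b2b-bsdres`, lane CLASS-CLOSURE, seat `cc-typer-6` GEN 11, O9 typer of record;
# theorems only — no definition, no named fact, nothing booked)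

HONEST FRAMING (run/shared/lean/b2b/bsd-rank1-residual/, verbatim in every file): the goal of the
cell is to DELETE the COMBINATION-SHAPED residual classes of the Birch–Swinnerton-Dyer formula for
ALL analytic-rank `≤ 1` elliptic curves over `ℚ` — "full BSD formula for every rank `≤ 1` curve in
class `C`" assembled STRICTLY from published theorems — so that the rank-`≤ 1` remainder becomes
exactly the CONSTRUCTION-SHAPED classes, which are TYPED (missing-input `Prop`s), NOT attempted.
This is not "finishing BSD". Lane CLASS-CLOSURE: research routes; no claim beyond the stated classes;
census / instrument output is EVIDENCE, never a Literature fact; per-pair certificates are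
INSTRUMENTATION (E4), never coverage. Every published theorem enters as one of the tree's named
Literature facts BY NAME; nothing about any particular curve is asserted; no label changes; X2c stays
CONSTRUCTION-SHAPED until referee A rules.

## What this file records

`ClassClosureO9OptimalMemberRiemannSum` (p295607) reads p291694's O9 non-split consumer on the
ENGINE-currency Riemann sum of the optimal member, with binders `hopt` (a lattice-optimal datum on `W`)
and `hcp` (`p ∤ c`). For a curve `W` with `(W, N) ∈ cremonaCurveOneO9Window` (the 118 curve-`1` minimal
models of the non-split O9 window, `N < 60000`) both binders are the two registered named facts of
`AgasheRibetStein2006/` — `cremona_optimal_curveOne_o9Window` (appendix Thm. 5.2, second sentence, on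
this list) and `cremona_abs_maninConstant_eq_one_of_level_le` (Thm. 2.6 / Thm. 5.2 first sentence) —
and the newform may be ANY `f` with `IsNewformOf W f` at level `N` (it equals the datum's, `IsNewformOf.unique`):

* `varpi_eq_one_of_mem_cremonaCurveOneO9Window` — on the list, every `ϖ` with `ϖ·Ω(W) = Ω⁺_f` equals `1`;
* `bsdp_of_cellCNonsplitGV_of_mem_cremonaCurveOneO9Window_of_thm1_of_neronRiemannSum_lt` —
  `(W, N) ∈` list ∧ `X2.CellCNonsplitGV W p` ∧ `hx` (the engine tabulates `x = κ·ϖ·[·]⁺_f`, `‖κ‖_p = 1`)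
  ∧ `p⁻ⁿ < ‖RSx 1 n‖` ⟹ `BSD(E,p)`, from the PUBLISHED named facts (A183 `hD`; GV00 at `p ‖ N` `hGV`,
  flag `GV00-mult-asserted`; Wuthrich Thm. 16 `hWu`; SW Thm. 6.1 `hJn`, §4.2 existence `hHn`; GZK;
  modularity `hpar`; ARS06 `h26`, `h52`);
* `bsdp_of_cellC_of_not_split_of_mazurMainConjectureAt_of_mem_cremonaCurveOneO9Window_…` — the other
  parity (`X2.CellCNonsplitNotGV`, + Mazur's MC at the pair).

READING for the lane (EVIDENCE bookkeeping, nothing booked): on the 57 + 61 non-split window cells the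
per-pair non-kernel content is now EXACTLY the instrument specification `hx` + the inequality row
(+ `hMC` on the notGV cells); every other input is a registered named fact. CONDITIONAL theorems; no
count moves; the split residue `X2.O9.ExceptionalLeadingTermAt` is untouched.

References: [AgasheRibetStein2006] Thm. 2.6, appendix Thm. 5.2 (p. 633); [Disegni2020] Thm. 1 (§1.2);
[GreenbergVatsal2000] Thm. (1.3); [SteinWuthrich2013] §3, §4.2, Thm. 6.1; [Wuthrich2014] Thm. 16;
[MazurTateTeitelbaum1986Invent] §I.10, §I.13; [CremonaAlgorithms1997] §2.8.
-/

set_option autoImplicit false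

noncomputable section

open scoped Classical MatrixGroups ModularForm

open CongruenceSubgroup WeierstrassCurve Literature.NumberTheory.EllipticCurves
  Literature.NumberTheory.EllipticCurves.ModularForms
  Literature.NumberTheory.EllipticCurves.Rank1Residual
  Literature.NumberTheory.EllipticCurves.Rank1Residual.Typed
  Literature.NumberTheory.EllipticCurves.GreenbergVatsal2000
  Literature.NumberTheory.EllipticCurves.Wuthrich2014
  Literature.NumberTheory.EllipticCurves.SteinWuthrich2013
  Literature.NumberTheory.EllipticCurves.Disegni2020
  Literature.NumberTheory.EllipticCurves.AgasheRibetStein2006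

namespace Summit.BirchSwinnertonDyer.Rank1Residual.X2

variable (W : WeierstrassCurve ℚ) [W.IsElliptic] [W.IsGloballyMinimal] (p : ℕ) [Fact p.Prime]
  {N : ℕ} [NeZero N]

/-- **On the 118 curve-`1` models of the non-split O9 window, `ϖ = 1`**: `Ω(W) = Ω⁺_f` for every
newform `f` of `W` at level `N`, from the two Agashe–Ribet–Stein facts (optimal datum on the list;
`|c| = 1` at level `≤ 130000`) and `varpi_eq_one_of_optimal_of_abs_maninConstant_eq_one`.
[cite: AgasheRibetStein2006, Thm. 2.6 and appendix Thm. 5.2 (p. 633)] [cite: CremonaAlgorithms1997, §2.8 (p. 26)] -/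
theorem varpi_eq_one_of_mem_cremonaCurveOneO9Window
    (h26 : cremona_abs_maninConstant_eq_one_of_level_le) (h52 : cremona_optimal_curveOne_o9Window)
    (hmem : (W, N) ∈ cremonaCurveOneO9Window) (f : CuspForm (Gamma0 N) 2) (hf : IsNewformOf W f)
    {ϖ : ℚ} (hϖ : (ϖ : ℝ) * W.realPeriodRat = plusPeriod f) : ϖ = 1 := by
  obtain ⟨D, hopt, h1, -⟩ := exists_optimal_abs_maninConstant_eq_one_of_mem_o9Window h26 h52 W N hmem
  have hDf : D.f = f := D.isNewformOf.unique hf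
  subst hDf
  exact varpi_eq_one_of_optimal_of_abs_maninConstant_eq_one D hopt h1 hϖ

section Consumers

variable {x : ℚ → ℚ} {κ ϖ : ℚ} {RSx : ℕ → ℕ → ℚ_[p]}
  (hRSx : ∀ k n : ℕ, RSx k n =
      ∑ᶠ ξ : rootsOfUnity (torsionOrder p) ℤ_[p], ∑ s : ZMod (p ^ n),
        (fun (n : ℕ) (a : ZMod (p ^ n)) ↦
            (-1 : ℚ_[p]) ^ n * (x ((a.val : ℚ) / (p : ℚ) ^ n) : ℚ_[p]))
          (n + cyclotomicExponent p)
            (PadicInt.toZModPow (n + cyclotomicExponent p) ((ξ : ℤ_[p]ˣ) : ℤ_[p]) *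
              (cyclotomicGenerator p : ZMod (p ^ (n + cyclotomicExponent p))) ^ s.val) *
          ((s.val.choose k : ℕ) : ℚ_[p]))

include hRSx

/-- **Non-split O9 window, Greenberg–Vatsal parity: list membership ∧ `X2.CellCNonsplitGV` ∧ `hx` ∧
ONE engine-currency inequality ⟹ `BSD(E,p)`.** For `(W, N) ∈ cremonaCurveOneO9Window` and ANY newform
`f` of `W` at level `N`: the engines' Néron-normalised symbol `x = κ·ϖ·[·]⁺_f` (`‖κ‖_p = 1`,
`ϖ·Ω(W) = Ω⁺_f`; here `ϖ = 1`) with `p⁻ⁿ < ‖RSx 1 n‖` gives `BSDp W p`, the optimality and Manin inputs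
being the registered facts `h52`, `h26` (p295607's `…_of_optimal_of_level_le_…` on the datum they
provide). PUBLISHED named facts only + the instrument row. CONDITIONAL; nothing booked.
[cite: AgasheRibetStein2006, Thm. 2.6 and appendix Thm. 5.2 (p. 633)] [cite: Disegni2020, Thm. 1 (§1.2)]
[cite: GreenbergVatsal2000, Thm. (1.3) with pp. 1, 14–15] [cite: Wuthrich2014, Thm. 16 (p. 397)]
[cite: SteinWuthrich2013, Thm. 6.1 (p. 20), §3, §4.2] -/
theorem bsdp_of_cellCNonsplitGV_of_mem_cremonaCurveOneO9Window_of_thm1_of_neronRiemannSum_lt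
    (h26 : cremona_abs_maninConstant_eq_one_of_level_le) (h52 : cremona_optimal_curveOne_o9Window)
    (hD : thm1_padicBSD_rankOne_multiplicative) (hGV : lambdaMu_multiplicative_of_gvPar)
    (hWu : thm16_charIdeal_dvd_multiplicative_of_reducible) (hJn : thm61_nonsplitMultiplicative)
    (hHn : exists_isMultCanonical) (hGZK : rank_eq_analyticRank_of_analyticRank_le_one)
    (hpar : nonempty_modularParametrizationData)
    (hmem : (W, N) ∈ cremonaCurveOneO9Window) (hc : CellCNonsplitGV W p)
    (f : CuspForm (Gamma0 N) 2) (hf : IsNewformOf W f) (hκ : ‖((κ : ℚ) : ℚ_[p])‖ = 1)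
    (hϖ : (ϖ : ℝ) * W.realPeriodRat = plusPeriod f) (hx : ∀ r, x r = κ * ϖ * ratPlusSymbol f r)
    {n : ℕ} (hlt : (p : ℝ) ^ (-n : ℤ) < ‖RSx 1 n‖) : BSDp W p := by
  obtain ⟨D, hopt, -, -⟩ := exists_optimal_abs_maninConstant_eq_one_of_mem_o9Window h26 h52 W N hmem
  have hDf : D.f = f := D.isNewformOf.unique hf
  subst hDf
  exact bsdp_of_cellCNonsplitGV_of_optimal_of_level_le_of_thm1_of_neronRiemannSum_lt W p D hRSx h26 hD
    hGV hWu hJn hHn hGZK hpar hc hopt (level_le_of_mem_cremonaCurveOneO9Window hmem) hκ hϖ hx hlt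

/-- **Non-split O9 window, the other parity: list membership ∧ X2c ∧ ¬split ∧ Mazur's MC at the pair ∧
`hx` ∧ ONE engine-currency inequality ⟹ `BSD(E,p)`** (p295607's Mazur-MC twin with `hopt`, `hcp` from
the registered Agashe–Ribet–Stein facts). CONDITIONAL; nothing booked.
[cite: AgasheRibetStein2006, Thm. 2.6 and appendix Thm. 5.2 (p. 633)] [cite: Disegni2020, Thm. 1 (§1.2)]
[cite: SteinWuthrich2013, Thm. 6.1 (p. 20), §3, §4.2] -/
theorem bsdp_of_cellC_of_not_split_of_mazurMainConjectureAt_of_mem_cremonaCurveOneO9Window_of_thm1_of_neronRiemannSum_lt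
    (h26 : cremona_abs_maninConstant_eq_one_of_level_le) (h52 : cremona_optimal_curveOne_o9Window)
    (hD : thm1_padicBSD_rankOne_multiplicative) (hJn : thm61_nonsplitMultiplicative)
    (hHn : exists_isMultCanonical) (hGZK : rank_eq_analyticRank_of_analyticRank_le_one)
    (hpar : nonempty_modularParametrizationData)
    (hmem : (W, N) ∈ cremonaCurveOneO9Window) (hc : CellC W p)
    (hns : ¬ W.HasSplitMultiplicativeReductionAtPrime p) (hMC : MazurMainConjectureAt W p)
    (f : CuspForm (Gamma0 N) 2) (hf : IsNewformOf W f) (hκ : ‖((κ : ℚ) : ℚ_[p])‖ = 1)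
    (hϖ : (ϖ : ℝ) * W.realPeriodRat = plusPeriod f) (hx : ∀ r, x r = κ * ϖ * ratPlusSymbol f r)
    {n : ℕ} (hlt : (p : ℝ) ^ (-n : ℤ) < ‖RSx 1 n‖) : BSDp W p := by
  obtain ⟨D, hopt, -, hall⟩ := exists_optimal_abs_maninConstant_eq_one_of_mem_o9Window h26 h52 W N hmem
  have hDf : D.f = f := D.isNewformOf.unique hf
  subst hDf
  exact bsdp_of_cellC_of_not_split_of_mazurMainConjectureAt_of_optimal_of_thm1_of_neronRiemannSum_lt W p
    D hRSx hD hJn hHn hGZK hpar hc hns hMC hopt (hall p Fact.out) hκ hϖ hx hlt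

end Consumers

end Summit.BirchSwinnertonDyer.Rank1Residual.X2

end
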